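import Literature.Geometry.ComplexHyperbolic.UnitBallJacobian
import Literature.Geometry.ComplexHyperbolic.UnitBallBounds

/-!
# A continuous global section of `U(2,1) → 𝔹²` and joint continuity of the canonical cocycle

For the ball model of `Literature.Geometry.ComplexHyperbolic.UnitBallU21` (`U21 = U(2,1)` preserving
`J = diag(1,1,-1)`, acting on the unit ball `Ball = 𝔹² ⊂ ℂ²` by projective transformations, base point `x₀ = 0`):

* (imported from `UnitBallBounds`) `mat_inv : mat g⁻¹ = J (mat g)ᴴ J` — the inverse in `U(2,1)` (`J_mul_J : J² = 1`);
* `secMat z` — the HERMITIAN BOOST `g_z = ((1 + a z z*, c z), (c z*, c))` with `t = (1 - |z|²)^{1/2}`, `c = 1/t`,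
  `a = 1/(t(1+t))` (so `a = c²/(1+c)`, written without singularity at `z = 0`): `secMat_mem : g_zᴴ J g_z = J`
  (three scalar identities, `sec_identities`), hence `sec z ∈ U(2,1)` with `sec_smul_x₀ : sec z • x₀ = z` and
  `continuous_sec`; so `exists_continuous_section`: the orbit map `g ↦ g • x₀ : U(2,1) → 𝔹²` has a continuous global
  section (in particular it is surjective — a second, case-free proof of `BallModel.transitive` — and `𝔹²` is the
  homogeneous space `U(2,1)/(U(2) × U(1))` with trivialised frame bundle);
* `continuous_Jac₂`, `continuous_coT₂` — the Jacobian `Jac g z` of `z ↦ g • z` and the cotangent cocycle `coT g z`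
  (`UnitBallJacobian`) are JOINTLY continuous in `(g, z)`.

Everything is explicit matrix algebra over Mathlib. [folklore] The classical continuous family of automorphisms
moving `0` to a prescribed point is Rudin's family of involutions `φ_a`, `φ_a(0) = a`, "the map `a → φ_a(z)` is
continuous on `B`" (W. Rudin, *Function Theory in the Unit Ball of ℂⁿ*, Springer 1980, §2.2.1 and Theorem 2.2.2 (i),
with Theorem 2.2.3: `Aut(B)` acts transitively, Theorem 2.2.5: `Aut(B) = 𝒰 · {φ_a}`); the boost `g_z` used here is
the positive Hermitian representative of the same coset of `U(2) × U(1)` (H. Jacobowitz, *An Introduction to CR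
Structures*, AMS 1990, ch. 2 §1 for `SU(2,1)` acting on the ball).

## Provenance

Staged by the pub-hodgecm formalisation cell (DAG-node prover #03 lineage) under the LEAN-IN-TREE rule; it is the
model-independent half of the cell's package file `HodgeCM/PerL34/BallFrame.lean` (namespace
`HodgeCM.PerL34.BallFrame` ↦ `Literature.Geometry.ComplexHyperbolic.BallModel`, names unchanged; the frame-function
half of that file refers to cell structures and is not reproduced here).

## Not here

Smoothness / real-analyticity of the section; the identification `𝔹² ≃ₜ U(2,1)/K` as a `Homeomorph` with the
quotient topology; general rank (`U(n,1)`), which is the same computation.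
-/

set_option autoImplicit false

noncomputable section

open Complex ComplexConjugate
open scoped Matrix

namespace Literature.Geometry.ComplexHyperbolic

namespace BallModel

/-! ## The inverse in `U(2,1)`

`J_mul_J : J * J = 1` and `mat_inv : mat g⁻¹ = J * (mat g)ᴴ * J` are used below from
`Literature.Geometry.ComplexHyperbolic.UnitBallBounds` (same namespace `BallModel`, identical statements;
this file originally re-proved them — removed at tree migration to keep one fully-qualified name per module). -/

/-! ## The global section `z ↦ g_z` -/

/-- `t(z) = (1 - |z|²)^{1/2}`. [folklore] -/
def tOf (z : Ball) : ℝ := Real.sqrt (1 - nsq z.1)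

/-- `t(z) > 0` on the open ball. [folklore] -/
theorem tOf_pos (z : Ball) : 0 < tOf z := Real.sqrt_pos.2 (by have := z.2; linarith)

/-- `t(z)² = 1 - |z|²`. [folklore] -/
theorem tOf_sq (z : Ball) : tOf z ^ 2 = 1 - nsq z.1 := Real.sq_sqrt (by have := z.2; linarith)

/-- `c(z) = 1/t(z) = (1 - |z|²)^{-1/2}`. [folklore] -/
def cOf (z : Ball) : ℝ := 1 / tOf z

/-- `a(z) = 1/(t(1+t)) = c²/(1+c)`. [folklore] -/
def aOf (z : Ball) : ℝ := 1 / (tOf z * (1 + tOf z))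

/-- `c(z) > 0`. [folklore] -/
theorem cOf_pos (z : Ball) : 0 < cOf z := by unfold cOf; exact div_pos one_pos (tOf_pos z)

/-- The Hermitian boost `g_z = ((1 + a z z*, c z), (c z*, c))` (a `3 × 3` matrix, block sizes `2 + 1`). [folklore] -/
def secMat (z : Ball) : Matrix (Fin 3) (Fin 3) ℂ :=
  !![1 + (aOf z : ℂ) * z.1 0 * conj (z.1 0), (aOf z : ℂ) * z.1 0 * conj (z.1 1), (cOf z : ℂ) * z.1 0;
     (aOf z : ℂ) * z.1 1 * conj (z.1 0), 1 + (aOf z : ℂ) * z.1 1 * conj (z.1 1), (cOf z : ℂ) * z.1 1;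
     (cOf z : ℂ) * conj (z.1 0), (cOf z : ℂ) * conj (z.1 1), (cOf z : ℂ)]

/-- The three scalar identities behind `g_zᴴ J g_z = J`: `2a + a²|z|² = c²`, `1 + a|z|² = c`, `c²(1-|z|²) = 1`.
[folklore] -/
theorem sec_identities (z : Ball) :
    (2 * (aOf z : ℂ) + (aOf z : ℂ) ^ 2 * (conj (z.1 0) * z.1 0 + conj (z.1 1) * z.1 1) = (cOf z : ℂ) ^ 2) ∧
    (1 + (aOf z : ℂ) * (conj (z.1 0) * z.1 0 + conj (z.1 1) * z.1 1) = (cOf z : ℂ)) ∧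
    ((cOf z : ℂ) ^ 2 * (1 - (conj (z.1 0) * z.1 0 + conj (z.1 1) * z.1 1)) = 1) := by
  have ht := tOf_pos z
  have ht0 : tOf z ≠ 0 := ht.ne'
  have ht1 : 1 + tOf z ≠ 0 := by have : (0 : ℝ) < 1 + tOf z := by linarith
                                 exact this.ne'
  have hs : nsq z.1 = 1 - tOf z ^ 2 := by rw [tOf_sq]; ring
  have hS : conj (z.1 0) * z.1 0 + conj (z.1 1) * z.1 1 = ((nsq z.1 : ℝ) : ℂ) := by
    rw [conj_mul', conj_mul']
    push_cast [nsq]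
    ring
  have h1 : 2 * aOf z + aOf z ^ 2 * nsq z.1 = cOf z ^ 2 := by
    simp only [aOf, cOf]; rw [hs]; field_simp; ring
  have h2 : 1 + aOf z * nsq z.1 = cOf z := by
    simp only [aOf, cOf]; rw [hs]; field_simp; ring
  have h3 : cOf z ^ 2 * (1 - nsq z.1) = 1 := by
    simp only [cOf]; rw [hs]; field_simp; ring
  refine ⟨?_, ?_, ?_⟩
  · rw [hS]; exact_mod_cast h1
  · rw [hS]; exact_mod_cast h2
  · rw [hS]; exact_mod_cast h3

/-- `g_zᴴ J g_z = J`: the boost preserves the form of signature `(2,1)`. [folklore] -/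
theorem secMat_mem (z : Ball) : (secMat z)ᴴ * J * secMat z = J := by
  obtain ⟨h1, h2, h3⟩ := sec_identities z
  ext i j
  fin_cases i <;> fin_cases j <;>
    simp [secMat, J, Matrix.mul_apply, Fin.sum_univ_three, Matrix.conjTranspose_apply, Matrix.diagonal_apply] <;>
    first
    | linear_combination (z.1 0 * conj (z.1 0)) * h1
    | linear_combination (z.1 0 * conj (z.1 1)) * h1
    | linear_combination (z.1 1 * conj (z.1 0)) * h1
    | linear_combination (z.1 1 * conj (z.1 1)) * h1
    | linear_combination ((cOf z : ℂ) * z.1 0) * h2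
    | linear_combination ((cOf z : ℂ) * z.1 1) * h2
    | linear_combination ((cOf z : ℂ) * conj (z.1 0)) * h2
    | linear_combination ((cOf z : ℂ) * conj (z.1 1)) * h2
    | linear_combination (-1 : ℂ) * h3

/-- The global section `sec : 𝔹² → U(2,1)`, `z ↦ g_z`. [folklore] -/
def sec (z : Ball) : U21 := mkU21 (secMat z) (secMat_mem z)

/-- The matrix of `sec z` is the boost `g_z`. [folklore] -/
@[simp] theorem mat_sec (z : Ball) : mat (sec z) = secMat z := rfl

/-- `g_z · x₀ = z`: the section is a section of the orbit map at the base point. [folklore] -/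
theorem sec_smul_x₀ (z : Ball) : sec z • x₀ = z := by
  have hc : (cOf z : ℂ) ≠ 0 := by exact_mod_cast (cOf_pos z).ne'
  apply Ball.ext
  intro i
  rw [smul_val, W3_apply, W3_apply]
  fin_cases i
  · simp [secMat]; field_simp
  · simp [secMat]; field_simp

/-- `t` is continuous on the ball (with `z ↦ |z|²` continuous on `ℂ²`). [folklore] -/
theorem continuous_tOf : Continuous tOf := by
  have hn : Continuous nsq := by
    unfold nsq
    exact ((continuous_norm.comp (continuous_apply 0)).pow 2).add ((continuous_norm.comp (continuous_apply 1)).pow 2)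
  exact Real.continuous_sqrt.comp (continuous_const.sub (hn.comp continuous_subtype_val))

/-- `c` is continuous on the ball. [folklore] -/
theorem continuous_cOf : Continuous cOf := by
  unfold cOf
  exact continuous_const.div continuous_tOf fun z => (tOf_pos z).ne'

/-- `a` is continuous on the ball (no singularity at `z = 0`). [folklore] -/
theorem continuous_aOf : Continuous aOf := by
  unfold aOf
  refine continuous_const.div (continuous_tOf.mul (continuous_const.add continuous_tOf)) fun z => ?_
  have h1 := tOf_pos z
  exact mul_ne_zero h1.ne' (by linarith : (0 : ℝ) < 1 + tOf z).ne'

/-- The boost matrix depends continuously on `z`. [folklore] -/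
theorem continuous_secMat : Continuous secMat := by
  have hu : Continuous fun z : Ball => z.1 0 := (continuous_apply 0).comp continuous_subtype_val
  have hv : Continuous fun z : Ball => z.1 1 := (continuous_apply 1).comp continuous_subtype_val
  have hcu : Continuous fun z : Ball => conj (z.1 0) := continuous_conj.comp hu
  have hcv : Continuous fun z : Ball => conj (z.1 1) := continuous_conj.comp hv
  have ha : Continuous fun z : Ball => (aOf z : ℂ) := continuous_ofReal.comp continuous_aOf
  have hc : Continuous fun z : Ball => (cOf z : ℂ) := continuous_ofReal.comp continuous_cOf
  refine continuous_matrix fun i j => ?_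
  fin_cases i <;> fin_cases j <;>
    simp only [secMat, Matrix.of_apply, Matrix.cons_val', Matrix.cons_val_zero, Matrix.cons_val_one,
      Matrix.empty_val', Matrix.cons_val_fin_one, Matrix.cons_val_two, Matrix.tail_cons, Matrix.head_cons,
      Fin.isValue, Fin.mk_one, Fin.reduceFinMk] <;>
    first
    | exact continuous_const.add ((ha.mul hu).mul hcu)
    | exact (ha.mul hu).mul hcv
    | exact hc.mul hu
    | exact (ha.mul hv).mul hcu
    | exact continuous_const.add ((ha.mul hv).mul hcv)
    | exact hc.mul hv
    | exact hc.mul hcu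
    | exact hc.mul hcv
    | exact hc

/-- The section is continuous (into `U(2,1) ≤ GL₃(ℂ)` with its group topology). [folklore] -/
theorem continuous_sec : Continuous sec := by
  have hval : Continuous fun z : Ball => ((sec z : GL3) : Matrix (Fin 3) (Fin 3) ℂ) := continuous_secMat
  have hinv : Continuous fun z : Ball => (((sec z : GL3)⁻¹ : GL3) : Matrix (Fin 3) (Fin 3) ℂ) := by
    have : ∀ z : Ball, (((sec z : GL3)⁻¹ : GL3) : Matrix (Fin 3) (Fin 3) ℂ) = J * (secMat z)ᴴ * J := fun z => by
      have h1 : J * (secMat z)ᴴ * J * secMat z = 1 := by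
        calc J * (secMat z)ᴴ * J * secMat z = J * ((secMat z)ᴴ * J * secMat z) := by simp only [Matrix.mul_assoc]
          _ = 1 := by rw [secMat_mem, J_mul_J]
      rw [Matrix.coe_units_inv]
      exact Matrix.inv_eq_left_inv h1
    simp_rw [this]
    exact (continuous_const.mul continuous_secMat.matrix_conjTranspose).mul continuous_const
  have hGL : Continuous fun z : Ball => (sec z : GL3) := Units.continuous_iff.2 ⟨hval, hinv⟩
  exact hGL.subtype_mk _

/-- **The orbit map `U(2,1) → 𝔹²`, `g ↦ g • x₀`, has a continuous global section.** [folklore]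
(Rudin 1980, §2.2.1 / Theorem 2.2.2 (i), gives another one: the involutions `φ_a`, `φ_a(0) = a`, continuous in `a`.) -/
theorem exists_continuous_section : ∃ s : Ball → U21, Continuous s ∧ ∀ z : Ball, s z • x₀ = z :=
  ⟨sec, continuous_sec, sec_smul_x₀⟩

/-! ## Joint continuity of the Jacobian and of the cotangent cocycle -/

/-- The Jacobian `Jac g z` of `z ↦ g • z` is jointly continuous in `(g, z)`. [folklore] -/
theorem continuous_Jac₂ : Continuous fun p : U21 × Ball => Jac p.1 p.2 := by
  have hm : Continuous fun p : U21 × Ball => mat p.1 := continuous_mat.comp continuous_fst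
  refine continuous_matrix fun i j => ?_
  simp only [Jac, Matrix.of_apply]
  exact (((hm.matrix_elem _ _).mul (continuous_W3 2)).sub ((continuous_W3 _).mul (hm.matrix_elem _ _))).div
    ((continuous_W3 2).pow 2) fun p => pow_ne_zero _ (W3_2_ne_zero p.1 p.2)

/-- The cotangent cocycle `coT g z = (Jac g z)ᵀ⁻¹` is jointly continuous in `(g, z)`. [folklore] -/
theorem continuous_coT₂ : Continuous fun p : U21 × Ball => coT p.1 p.2 := by
  have hJ := continuous_Jac₂
  have hd : Continuous fun p : U21 × Ball => ((Jac p.1 p.2).det)⁻¹ :=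
    (hJ.matrix_det).inv₀ fun p => det_Jac_ne_zero p.1 p.2
  refine hd.smul (continuous_matrix fun i j => ?_)
  fin_cases i <;> fin_cases j <;>
    simp only [Matrix.of_apply, Matrix.cons_val', Matrix.empty_val', Matrix.cons_val_fin_one]
  · exact hJ.matrix_elem 1 1
  · exact (hJ.matrix_elem 1 0).neg
  · exact (hJ.matrix_elem 0 1).neg
  · exact hJ.matrix_elem 0 0

/-- The fibre maps `A g z = coT g z ·` of `UnitBallJacobian` are jointly continuous in `(g, z, w)`. [folklore] -/
theorem A_continuous₂ : Continuous fun p : (U21 × Ball) × (Fin 2 → ℂ) => A p.1.1 p.1.2 p.2 := by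
  simp only [A_apply]
  exact (continuous_coT₂.comp continuous_fst).matrix_mulVec continuous_snd

end BallModel

end Literature.Geometry.ComplexHyperbolic

end
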